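import Summits.ResolutionOfSingularities.ResolutionOfSingularities.Theorems.UniversalCellsCampaignW82FamilyTransferGraded
import Summits.ResolutionOfSingularities.ResolutionOfSingularities.Theorems.UniversalCellsCampaignW82FamilyTransferCore
import Literature.AlgebraicGeometry.Resolution.ResolutionOfCurves
import HarnessLib

/-!
# [OURS · L1 W8.2] PROOFS of the slot's theorems-to-prove `CampaignW82.FgFieldTransferShift p` and
# `CampaignW82.FamilyTransferSucc p` (graded family transfer along finitely generated field extensions), and
# the reduction of the graded kernel to the perfection step

Cell `res-hironaka` (run/shared/lean/pub/res-hironaka/), LADDER-RESOLUTION rung L (RESCUE), slot W8.2 of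
plan/RESCUE-SEED.md, host route `UniversalCells`, host item `PrimeFieldToPerfect`
(stmt-ResolutionOfSingularities-15233). Prover res-L1-s82-pv-1. THESES-FREE module: imports the OURS
statement file Theorems/UniversalCellsCampaignW82FamilyTransferGraded.lean (typer res-L1-type-o6; names
`SpreadOutRatFuncDimLe`, `SpreadOutFgFieldDimLe`, `PerfectionStepDimLe`, `FamilyTransferSucc`,
`FgFieldTransferShift`), the core theorem Theorems/UniversalCellsCampaignW82FamilyTransferCore.lean
(`integralResolutionOverUpToDim_of_isFractionRing`, this seat) and the tree's resolution of curves.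

WHAT IS PROVED (sorry-free; unconditional except the one rung marked F-02):

* `fgFieldTransferShift_holds : FgFieldTransferShift p` — **the slot's SECOND theorem-to-prove HOLDS**: for
  every `d : ℕ` and `n : WithBot ℕ∞`, resolution of integral separated schemes of finite type of dimension
  `≤ n + d` over a field `M` (of characteristic `p` — unused) implies resolution of those of dimension `≤ n`
  over every field `K` finitely generated over `M` (`(⊤ : IntermediateField M K).FG`) with `trdeg_M K ≤ d`.
  Cases `n = ⊥` (vacuous: integral schemes have dimension `≠ ⊥`), `n = ⊤` (the ungraded transfer
  `integralRes_of_isFractionRing`), `n` finite (`integralResolutionOverUpToDim_of_isFractionRing` with the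
  affine model `A = M[s]`, `s` a finite field-generating set, `Frac M[s] = K` by
  `IntermediateField.mem_adjoin_iff_div`, `dim M[s] ≤ d` by `ringKrullDim_le_of_fg_of_trdeg_le`).
* `familyTransferSucc_holds : FamilyTransferSucc p` — **the FIRST theorem-to-prove HOLDS** (`d = 1`,
  `K = RatFunc M`, via the statement file's `familyTransferSucc_of_fgFieldTransferShift`).
* `spreadOutFgFieldDimLe_of_add_le`, `spreadOutRatFuncDimLe_of_add_one_le`, `spreadOutRatFuncDimLe_top_top` —
  every grade `(d, m, n)` with `n + d ≤ m`, resp. `(m, n)` with `n + 1 ≤ m`, and the ungraded `(⊤, ⊤)`.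
* `climbRatFuncPerfDimLe_succ_of_perfectionStep`, `climbRatFuncPerfDimLe_of_perfectionStep` — **the graded
  kernel `ClimbRatFuncPerfDimLe p (n + 1) n` (Theorems/UniversalCellsCampaignW82ClimbKernelGraded.lean, p466046)
  IS the perfection step `PerfectionStepDimLe p n`**: the finite level is now a theorem, so the first open
  kernel rung `(5, 4)` is exactly `PerfectionStepDimLe p 4` — the slot's residual, where the transport barriers
  (`Literature/Barriers/ResolutionOfSingularities/{RegularNotGeometricallyRegular, FrobeniusTwistResolution,
  InseparableBaseChangeResolution}.lean`) live.
* `perfectionStepDimLe_of_le_one` (unconditional, curves) and `perfectionStepDimLe_of_le_three` (⇐ named fact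
  F-02 `CossartPiltant2019`, taken as the hypothesis `hCP`) — the rungs of the perfection step below the open
  range.

HONEST FRAMING. OURS theorems about OURS statements that replace the role of §17 ¶2, p.89 l.59–62 of
H. Hironaka's 2017 manuscript ([Hironaka2017]) for finitely generated ground fields; NOT statements of the
manuscript; nothing here is attributed to its author; no typed candidate of the manuscript is used, even as
a hypothesis. What remains open in slot W8.2 after this file: `PerfectionStepDimLe p n` for `n ≥ 4`
(equivalently the kernel grades `(m, n)`, `m ≥ n + 1`, `n ≥ 4`). AI work, weaker than expert review.

## References (locators)
* H. Matsumura, *Commutative Ring Theory*, Thm. 5.6, 15.5. [Matsumura1987]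
* A. Grothendieck, J. Dieudonné, EGA IV₃, Thm. 8.8.2 (ii). [EGAIV3]
* V. Cossart, O. Piltant, J. Algebra 529 (2019), Thm. 1.1 — named fact F-02. [CossartPiltant2019]
* R. Hartshorne, *Algebraic Geometry* (1977), Ch. V Rem. 3.8.1 — curves. [Hartshorne1977]
* plan/RESCUE-SEED.md row W8.2; L/SLOTS.md §2 W8.2; res-L1-type-o6's statement file p-id in L/SLOTS.md.
-/

noncomputable section

set_option linter.dupNamespace false -- mandated namespace of this single-conjunct summit

open CategoryTheory AlgebraicGeometry
open Literature.AlgebraicGeometry.Resolution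

namespace Summit.ResolutionOfSingularities.ResolutionOfSingularities.Theorems.CampaignW82

universe u

/-! ## The slot's theorems-to-prove, BY NAME (statement file
`Theorems/UniversalCellsCampaignW82FamilyTransferGraded.lean`) -/

/-- An integral scheme has dimension `≠ ⊥` (it is non-empty and irreducible, so `IrreducibleCloseds X` is
non-empty). [folklore] -/
theorem topologicalKrullDim_ne_bot_of_isIntegral (X : Scheme.{u}) [IsIntegral X] :
    topologicalKrullDim X ≠ ⊥ := by
  unfold topologicalKrullDim
  rw [ne_eq, Order.krullDim_eq_bot_iff, not_isEmpty_iff]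
  exact ⟨⟨Set.univ, IrreducibleSpace.isIrreducible_univ X, isClosed_univ⟩⟩

/-- **`CampaignW82.FgFieldTransferShift p` HOLDS** (the slot's second theorem-to-prove, hence the first): for
every `d : ℕ` and every `n : WithBot ℕ∞`, `SpreadOutFgFieldDimLe p d (n + d) n` — resolution of integral
separated schemes of finite type of dimension `≤ n + d` over a field `M` (of characteristic `p`; not used)
implies resolution of those of dimension `≤ n` over every field `K` finitely generated over `M` of
transcendence degree `≤ d`. Cases: `n = ⊥` vacuous (integral schemes have dimension `≠ ⊥`); `n = ⊤`: the
ungraded transfer `integralRes_of_isFractionRing`; `n` finite: `integralResolutionOverUpToDim_of_trdeg_le`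
with `A = M[s]` for a finite field-generating set `s` (`Frac M[s] = K` by
`IntermediateField.mem_adjoin_iff_div`). [folklore] -/
theorem fgFieldTransferShift_holds (p : ℕ) : FgFieldTransferShift p := by
  intro d n M _ _ hM K _ _ hfg htr X f hs hl hq hX hdim
  classical
  -- an affine model `A = M[s]` of `K / M`
  obtain ⟨s, hsK⟩ := hfg
  let A : Subalgebra M K := Algebra.adjoin M (s : Set K)
  have hAfg : A.FG := ⟨s, rfl⟩
  haveI : Algebra.FiniteType M A := A.fg_iff_finiteType.mp hAfg
  haveI : IsFractionRing A K := by
    refine IsFractionRing.of_field A K fun z => ?_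
    have hz : z ∈ IntermediateField.adjoin M (s : Set K) := by
      rw [hsK]; exact IntermediateField.mem_top
    obtain ⟨r, hr, t, ht, e⟩ := IntermediateField.mem_adjoin_iff_div.mp hz
    exact ⟨⟨r, hr⟩, ⟨t, ht⟩, e⟩
  have hAdim : ringKrullDim A ≤ d := ringKrullDim_le_of_fg_of_trdeg_le A hAfg htr
  haveI := hs; haveI := hl; haveI := hq; haveI := hX
  induction n using WithBot.recBotCoe with
  | bot =>
    -- `⊥ + d = ⊥`: no integral scheme has dimension `≤ ⊥`
    exfalso
    exact topologicalKrullDim_ne_bot_of_isIntegral X (le_bot_iff.mp hdim)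
  | coe n =>
    induction n using ENat.recTopCoe with
    | top =>
      -- `⊤ + d = ⊤`: the ungraded transfer
      refine integralRes_of_isFractionRing (k := M) (↥A) K (fun Y g hs' hl' hq' hY => ?_) X f
      refine hM Y g hs' hl' hq' hY ?_
      have e : ((⊤ : ℕ∞) : WithBot ℕ∞) + (d : WithBot ℕ∞) = ⊤ := by
        rw [← WithBot.coe_natCast, ← WithBot.coe_add, top_add, WithBot.coe_top]
      rw [e]
      exact le_top
    | coe n =>
      have h' : IntegralResolutionOverUpToDim M (n + d) := by
        intro Y g hs' hl' hq' hY hdY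
        refine hM Y g hs' hl' hq' hY ?_
        refine hdY.trans (le_of_eq ?_)
        push_cast
        rfl
      exact integralResolutionOverUpToDim_of_isFractionRing (k := M) (↥A) K hAdim h' X f hs hl hq hX
        (by exact_mod_cast hdim)

/-- **`CampaignW82.FamilyTransferSucc p` HOLDS** (the slot's first theorem-to-prove): for every
`n : WithBot ℕ∞`, `SpreadOutRatFuncDimLe p (n + 1) n` — resolution of integral separated schemes of finite type
of dimension `≤ n + 1` over a field `M` implies resolution of those of dimension `≤ n` over `RatFunc M`
(`d = 1`, `K = RatFunc M` in `fgFieldTransferShift_holds`, via the statement file's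
`familyTransferSucc_of_fgFieldTransferShift`). [folklore] -/
theorem familyTransferSucc_holds (p : ℕ) : FamilyTransferSucc p :=
  familyTransferSucc_of_fgFieldTransferShift (fgFieldTransferShift_holds p)

/-- **`CampaignW82.FgFieldTransferShiftNat p` HOLDS** (the ℕ-indexed packaging of the statement file's v2,
stated with the tree predicate `IntegralResolutionOverUpToDim`; from `fgFieldTransferShift_holds` by the
statement file's anchor). [folklore] -/
theorem fgFieldTransferShiftNat_holds (p : ℕ) : FgFieldTransferShiftNat p :=
  fgFieldTransferShiftNat_of_fgFieldTransferShift (fgFieldTransferShift_holds p)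

/-- **`CampaignW82.FamilyTransferSuccNat p` HOLDS**: for every `n : ℕ` and every field `M` of characteristic
`p`, `IntegralResolutionOverUpToDim M (n + 1) → IntegralResolutionOverUpToDim (RatFunc M) n`. [folklore] -/
theorem familyTransferSuccNat_holds (p : ℕ) : FamilyTransferSuccNat p :=
  familyTransferSuccNat_of_familyTransferSucc (familyTransferSucc_holds p)

/-- Every grade of the finite-level transfers holds: `SpreadOutFgFieldDimLe p d m n` whenever `n + d ≤ m`
(monotonicity from the rung `(d, n + d, n)`). [folklore] -/
theorem spreadOutFgFieldDimLe_of_add_le (p d : ℕ) {m n : WithBot ℕ∞} (h : n + d ≤ m) :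
    SpreadOutFgFieldDimLe p d m n :=
  spreadOutFgFieldDimLe_mono le_rfl h le_rfl (fgFieldTransferShift_holds p d n)

/-- `SpreadOutRatFuncDimLe p m n` whenever `n + 1 ≤ m`; in particular `(5, 4)`, `(⊤, n)`, `(⊤, ⊤)`.
[folklore] -/
theorem spreadOutRatFuncDimLe_of_add_one_le (p : ℕ) {m n : WithBot ℕ∞} (h : n + 1 ≤ m) :
    SpreadOutRatFuncDimLe p m n :=
  spreadOutRatFuncDimLe_mono h le_rfl (familyTransferSucc_holds p n)

/-- **The ungraded finite-level transfer holds**: `SpreadOutRatFuncDimLe p ⊤ ⊤` — resolution of all integral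
separated schemes of finite type over a field `M` ⇒ the same over `RatFunc M` (every FINITE level of the W8.2
climb is free; only the perfection step remains). [folklore] -/
theorem spreadOutRatFuncDimLe_top_top (p : ℕ) : SpreadOutRatFuncDimLe p ⊤ ⊤ :=
  spreadOutRatFuncDimLe_top_of_familyTransferSucc (familyTransferSucc_holds p)

/-! ## Consequences for the graded kernel: everything reduces to the perfection step -/

/-- **The graded kernel at `(n + 1, n)` IS the perfection step at grade `n`** (the finite level being a
theorem): `PerfectionStepDimLe p n → ClimbRatFuncPerfDimLe p (n + 1) n`. In particular the first open kernel
rung `(5, 4)` is exactly `PerfectionStepDimLe p 4`. [folklore] -/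
theorem climbRatFuncPerfDimLe_succ_of_perfectionStep {p : ℕ} {n : WithBot ℕ∞}
    (h : PerfectionStepDimLe p n) : ClimbRatFuncPerfDimLe p (n + 1) n :=
  climbRatFuncPerfDimLe_of_spreadOut_of_perfectionStep (familyTransferSucc_holds p n) h

/-- `PerfectionStepDimLe p n → ClimbRatFuncPerfDimLe p m n` for every `m ≥ n + 1` (e.g. `m = ⊤`). [folklore] -/
theorem climbRatFuncPerfDimLe_of_perfectionStep {p : ℕ} {m n : WithBot ℕ∞} (hm : n + 1 ≤ m)
    (h : PerfectionStepDimLe p n) : ClimbRatFuncPerfDimLe p m n :=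
  climbRatFuncPerfDimLe_of_spreadOut_of_perfectionStep (spreadOutRatFuncDimLe_of_add_one_le p hm) h

/-- **Perfection step, rung `n ≤ 1`, UNCONDITIONAL** (curves over the perfect field `L`: the tree's
`hasResolution_of_dim_le_one`; hypothesis unused). [folklore] -/
theorem perfectionStepDimLe_of_le_one (p : ℕ) {n : WithBot ℕ∞} (hn : n ≤ 1) : PerfectionStepDimLe p n := by
  intro M _ _ _ _ L _ _ _ _ X f _ hl hq hX hd
  haveI := hl
  haveI := hq
  exact hasResolution_of_dim_le_one X f (hd.trans hn)

/-- **Perfection step, rung `n ≤ 3`, CONDITIONAL on the named fact F-02 `CossartPiltant2019`** (taken as the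
hypothesis `hCP`; hypothesis over `RatFunc M` unused). So `PerfectionStepDimLe p 4` is the first open rung of
slot W8.2, and by `climbRatFuncPerfDimLe_succ_of_perfectionStep` it is all that the kernel rung `(5, 4)` needs.
[cite: CossartPiltant2019, Thm. 1.1] -/
theorem perfectionStepDimLe_of_le_three (hCP : CossartPiltant2019.{0}) (p : ℕ) {n : WithBot ℕ∞}
    (hn : n ≤ 3) : PerfectionStepDimLe p n := by
  intro M _ _ _ _ L _ _ _ _ X f hs hl hq hX hd
  exact hCP L X f hs hl hq inferInstance (hd.trans hn)

/-! ## The perfection step at the top grade carries the whole kernel (appended) -/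

/-- **The top grade of the kernel from the perfection step at grade `⊤` alone**:
`PerfectionStepDimLe p ⊤ → ClimbRatFuncPerfDimLe p ⊤ ⊤` — the finite level `SpreadOutRatFuncDimLe p ⊤ ⊤`
being a theorem (`spreadOutRatFuncDimLe_top_top`), the registered kernel of slot W8.2 (stmt-15233 /
stmt-8933's `stub_climbRatFuncPerf`, = grade `(⊤, ⊤)` by `climbRatFuncPerfDimLe_top_iff`) hangs on the
perfection step ONLY. [folklore] -/
theorem climbRatFuncPerfDimLe_top_top_of_perfectionStep_top {p : ℕ} (h : PerfectionStepDimLe p ⊤) :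
    ClimbRatFuncPerfDimLe p ⊤ ⊤ :=
  climbRatFuncPerfDimLe_of_spreadOut_of_perfectionStep (spreadOutRatFuncDimLe_top_top p) h

/-- Hence every grade `(⊤, n)` of the kernel from the perfection step at `⊤` (antitone in `n`). [folklore] -/
theorem climbRatFuncPerfDimLe_top_of_perfectionStep_top {p : ℕ} (h : PerfectionStepDimLe p ⊤)
    (n : WithBot ℕ∞) : ClimbRatFuncPerfDimLe p ⊤ n :=
  climbRatFuncPerfDimLe_mono le_rfl le_top (climbRatFuncPerfDimLe_top_top_of_perfectionStep_top h)

/-! ## Low grades of the finite-level transfers that hold for EVERY hypothesis bound (appended) -/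

/-- `SpreadOutRatFuncDimLe p m n` for `n ≤ 1` and EVERY `m` (also `m = ⊥`, idle hypothesis): integral
curves over the field `RatFunc M` are resolved unconditionally (`hasResolution_of_dim_le_one`). [folklore] -/
theorem spreadOutRatFuncDimLe_of_le_one (p : ℕ) (m : WithBot ℕ∞) {n : WithBot ℕ∞} (hn : n ≤ 1) :
    SpreadOutRatFuncDimLe p m n := by
  intro M _ _ _ X f _ hl hq hX hd
  haveI := hl
  haveI := hq
  exact hasResolution_of_dim_le_one X f (hd.trans hn)

/-- `SpreadOutFgFieldDimLe p d m n` for `n ≤ 1` and EVERY `d`, `m`: curves over any field. [folklore] -/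
theorem spreadOutFgFieldDimLe_of_le_one (p d : ℕ) (m : WithBot ℕ∞) {n : WithBot ℕ∞} (hn : n ≤ 1) :
    SpreadOutFgFieldDimLe p d m n := by
  intro M _ _ _ K _ _ _ _ X f _ hl hq hX hd
  haveI := hl
  haveI := hq
  exact hasResolution_of_dim_le_one X f (hd.trans hn)

/-- `SpreadOutRatFuncDimLe p m n` for `n ≤ 3` and EVERY `m`, CONDITIONAL on the named fact F-02
`CossartPiltant2019` (hypothesis `hCP`). Together with `spreadOutRatFuncDimLe_of_add_one_le` this settles every
grade `(m, n)` of the finite-level transfer except `n ≥ 4 ∧ m ≤ n` (where the hypothesis over `M` is too weak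
to be used by a family over a curve and the conclusion is open). [cite: CossartPiltant2019, Thm. 1.1] -/
theorem spreadOutRatFuncDimLe_of_le_three (hCP : CossartPiltant2019.{0}) (p : ℕ) (m : WithBot ℕ∞)
    {n : WithBot ℕ∞} (hn : n ≤ 3) : SpreadOutRatFuncDimLe p m n := by
  intro M _ _ _ X f hs hl hq hX hd
  exact hCP (RatFunc M) X f hs hl hq inferInstance (hd.trans hn)

/-- `SpreadOutFgFieldDimLe p d m n` for `n ≤ 3` and EVERY `d`, `m`, CONDITIONAL on F-02. [cite: CossartPiltant2019, Thm. 1.1] -/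
theorem spreadOutFgFieldDimLe_of_le_three (hCP : CossartPiltant2019.{0}) (p d : ℕ) (m : WithBot ℕ∞)
    {n : WithBot ℕ∞} (hn : n ≤ 3) : SpreadOutFgFieldDimLe p d m n := by
  intro M _ _ _ K _ _ _ _ X f hs hl hq hX hd
  exact hCP K X f hs hl hq inferInstance (hd.trans hn)

/-- **The headline grade**: the first open rung `(5, 4)` of the graded kernel of slot W8.2 is EXACTLY the
perfection step at grade `4` — `PerfectionStepDimLe p 4 → ClimbRatFuncPerfDimLe p 5 4`. [folklore] -/
theorem climbRatFuncPerfDimLe_five_four_of_perfectionStep_four {p : ℕ} (h : PerfectionStepDimLe p 4) :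
    ClimbRatFuncPerfDimLe p 5 4 := by
  have h' := climbRatFuncPerfDimLe_succ_of_perfectionStep h
  have e : (4 : WithBot ℕ∞) + 1 = 5 := by norm_num
  rwa [e] at h'

end Summit.ResolutionOfSingularities.ResolutionOfSingularities.Theorems.CampaignW82

end
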